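import Summits.BirchSwinnertonDyer.BirchSwinnertonDyer.Theorems.SchneiderFreeAdditiveX3KrizLiLineData
import Summits.BirchSwinnertonDyer.BirchSwinnertonDyer.Theorems.SchneiderFreeAdditiveX3KrizLiRoadThirtySevenRow
import Summits.BirchSwinnertonDyer.BirchSwinnertonDyer.Theorems.SchneiderFreeAdditiveX3GordCellRowPrimes
import Summits.BirchSwinnertonDyer.BirchSwinnertonDyer.Theorems.SchneiderFreeAdditiveX3PotMultCellRowPrimes
import Summits.BirchSwinnertonDyer.BirchSwinnertonDyer.Theorems.SchneiderFreeAdditiveX3ControlLeMinimal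
import Summits.BirchSwinnertonDyer.BirchSwinnertonDyer.Theorems.SchneiderFreeAdditiveX3StepLEquivBranch
import Summits.BirchSwinnertonDyer.BirchSwinnertonDyer.Theorems.SchneiderFreeAdditiveX3AnticycControlAdditiveK
import HarnessLib

/-!
# The K1 rung leaf with crux r3's `p = 37` instance REPLACED by the Kriz–Li road: `SchneiderFree.AdditiveX3RankOneLower` ⟸ `PrintedFacts` ∧
# Mazur's two isogeny theorems ∧ Kriz–Li Thm. 1.20 (all PUBLISHED) ∧ r2's instances at `p ∈ {3, 5, 7, 13}` ∧ r3's instances at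
# `p ∈ {3, 5, 7, 13}` ∧ «a Bernoulli certificate for every line presentation on the `p = 37` row» (route `SchneiderFreeAdditiveX3`)

Cell `bsd-schneider-ideate`, seat `bsd-schneider-door-c5` (prover, generation 37; assembly layer; `--supports` 19177 as helper).
PARTITION: board row B6 ∩ X3 ∩ sst-twist, `r = 1` (7 101 census pairs + the empty-in-census `p = 37` row) — ASSEMBLY; types-the-object-of
nothing new; closes none of B6's cells; BSD NOT advanced; «closes rung: none».  bears_on: K1-door (19177; generation 35's
`KYBranchLeafRowPrimes.additiveX3RankOneLower_of_printedFacts_of_rowPrimes`: the leaf from `PrintedFacts`, Mazur ×2 and the nine (cell, prime)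
instance families r2@{3,5,7,13}, r3@{3,5,7,13,37}).

WHAT.  §1 **`missingLowerBoundAt_of_printedFacts_of_imcLowerInputAt`** — the leaf's body `MissingLowerBoundAt W p` at ONE pair from
`PrintedFacts` and the crux currency `AdditiveIMCLowerBDPInputManinAt W p` AT THAT PAIR (pointwise reading of door-c4's
`additiveX3RankOneLower_of_printedFacts_of_pt_of_branchIMCs`: control `anticycControlAdditiveK_proof`, STEP L pointwise
`additiveStepLInputManinAt_of_kolyvagin_of_control_of_imcLower`, Heegner/twist data, Gross–Zagier bookkeeping, partner's upper half,
`missingLowerBoundAt_of_joint_of_upper`).  §2 **`additiveX3RankOneLower_of_printedFacts_of_rowPrimes_of_bernoulli37`** — the rung leaf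
with r3's `p = 37` instance TRADED for this seat's Kriz–Li road on the `p = 37` row (`KrizLiLineData…forall_linePresentation_five_le` with (2)
from `KrizLiThirtySevenRow`; (1), (3) automatic): inputs `PrintedFacts`, `mazur_isogeny_irreducible`, Mazur's `j`-table, Kriz–Li Thm. 1.20 —
PUBLISHED — plus r2@{3,5,7,13}, r3@{3,5,7,13} (Keller–Yin's preprint now needed at FOUR primes, not five) and, on the `p = 37` row, one Bernoulli
certificate `(K, ε_K, (4))` per line presentation `(T, r, f, φ)` and Teichmüller `ω` (kit j336110: satisfied at the first `r_an = 1` member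
`1225h1^{(37)}` with `K = ℚ(√−139)`).

HONEST FRAMING: compositions of tree theorems, CONDITIONAL on every displayed hypothesis (the eight r2/r3 instance families are exactly what
items 19176/19177 still owe at those primes — OPEN; the Bernoulli supply on the `p = 37` row is an explicit arithmetic hypothesis, class-wide
NOT claimed); no definition, no named fact introduced, no `sorry`; nothing is closed; BSD is proved for no curve; «closes rung: none».
References: [KrizLi2019] Thm. 1.20; [Mazur1978] Thm. 1, table p. 129; [JetchevSkinnerWan2017] §7.4.1; [GrossZagier1986] I.(6.3); this seat
p746370 (F29), p746654 (F30), generation 35 p739034/p739345/p740113, door-c4 `…ControlLeMinimal`, generation 7 `…StepLEquivBranch`.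
-/

set_option autoImplicit false
-- `Summit.<P>.<Sub>` repeats `BirchSwinnertonDyer` by the tree's layout convention (D-0017)
set_option linter.dupNamespace false

noncomputable section

open scoped Classical NumberField

open Field NumberField IsDedekindDomain WeierstrassCurve
open Literature.NumberTheory.EllipticCurves Literature.NumberTheory.EllipticCurves.GreenbergSelmer
open Literature.NumberTheory.GaloisRepresentations
open Literature.NumberTheory.GaloisCohomology
open Literature.NumberTheory.EllipticCurves.ModularForms
  Literature.NumberTheory.EllipticCurves.Rank1Residual
  Literature.NumberTheory.EllipticCurves.Rank1Residual.Typed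
  Literature.NumberTheory.EllipticCurves.KrizLi2019
  Summit.BirchSwinnertonDyer.Rank1Residual
  Summit.BirchSwinnertonDyer.Rank1Residual.X11b
  Summit.BirchSwinnertonDyer.Rank1Residual.X11b.AcSelmer
  Summit.BirchSwinnertonDyer.BirchSwinnertonDyer.Theorems.SchneiderFree
  Summit.BirchSwinnertonDyer.BirchSwinnertonDyer.Theorems.SchneiderFreeControlAtoms
  Summit.BirchSwinnertonDyer.BirchSwinnertonDyer.Theses.SchneiderFreeAdditiveX3

namespace Summit.BirchSwinnertonDyer.BirchSwinnertonDyer.Theorems.SchneiderFreeAdditiveX3.KrizLiLeafThirtySeven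

/-! ### §1 The leaf's body at ONE pair from the crux currency at that pair -/

/-- **The leaf's body at ONE pair from the crux currency at that pair.**  For `W/ℚ` globally minimal, `r_an(W) = 1`, `p` odd, `ClassX3 W p`,
semistable twist at `p`: `PrintedFacts` and `AdditiveIMCLowerBDPInputManinAt W p` (the branch cruxes' common currency, at this pair only) give
`MissingLowerBoundAt W p`.  Control: `anticycControlAdditiveK_proof` (Kolyvagin from `PrintedFacts`); STEP L at the pair:
`additiveStepLInputManinAt_of_kolyvagin_of_control_of_imcLower`; then Heegner/twist data, the Gross–Zagier bookkeeping `JointLowerManin`, the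
partner's upper half and `missingLowerBoundAt_of_joint_of_upper` — door-c4's `…_of_pt_of_branchIMCs`, read pointwise.  CONDITIONAL on `hF`
and `h1`. [cite: JetchevSkinnerWan2017, §7.4.1 (arXiv:1512.06894 p. 30)] [cite: GrossZagier1986, Thm. I.(6.3)] -/
theorem missingLowerBoundAt_of_printedFacts_of_imcLowerInputAt (hF : PrintedFacts)
    (W : WeierstrassCurve ℚ) [W.IsElliptic] [W.IsGloballyMinimal] (p : ℕ) [Fact p.Prime]
    (hr : W.analyticRank = 1) (hp2 : p ≠ 2) (hX : ClassX3 W p) (hS : Additive.SubSemistableTwist W p)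
    (h1 : AdditiveIMCLowerBDPInputManinAt W p) : MissingLowerBoundAt W p := by
  have hK : HeegnerTwistData := schneiderFreeAdditiveX3_heegnerTwistData_proof
  have hJ : JointLowerManin := schneiderFreeAdditiveX3_jointLowerManin_proof
  have hU : PartnerUpperRankZero := schneiderFreeAdditiveX3_partnerUpperRankZero_proof
  obtain ⟨hGZ, hKo, hGZK, hmod, hmodD, hCas, hGZ73, hFH, hpar, hHP, hDel, hW16, hWu⟩ := hF
  have h4 : AdditiveControlInputManinAt W p := anticycControlAdditiveK_proof hKo W p hr hp2 hX hS
  have hstep : AdditiveStepLInputManinAt W p :=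
    additiveStepLInputManinAt_of_kolyvagin_of_control_of_imcLower (fun N _ K _ _ => hKo N W K) h4 h1
  have hdata : HeegnerTwistDataManinAt W p := hK hFH hpar hHP hGZ hmod hmodD W p hr hp2 hX hS
  obtain ⟨N, _, K, _, _, Dt, H, ι, P, Wd, _, _, hN, hKiq, hodd, hunit, hHe, hLtw, hP, hnt, hWd,
    hrd, hXd, hSd⟩ := hdata
  have hloc : Additive.N10.Locus W p :=
    (Additive.N10.locus_iff_cells W p).mpr
      ((Additive.N10.cellM_or_cellGordTwo_of_classX3_of_subSemistableTwist W p hp2 hX hS).elim Or.inl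
        (fun h ↦ Or.inr (Or.inl h)))
  have hidx : IndexLowerBoundLeAt W p K P (padicValNat p Dt.c.natAbs) :=
    hstep N K Dt H ι P hr hloc hN hKiq hodd hunit hHe hLtw hP hnt
  have hJ' : JointLowerBoundAt W Wd p :=
    hJ hGZ hKo hGZK hmod hmodD hCas hGZ73 W p N K Dt H ι P Wd hr hN hKiq hodd hunit hHe hLtw hP hnt hWd
      hrd hp2 hidx
  exact missingLowerBoundAt_of_joint_of_upper hJ' (hU hDel hGZK hmod hmodD hW16 hWu Wd p hrd hp2 hXd hSd)

/-! ### §2 The rung leaf with the crux's `p = 37` instance traded for the Bernoulli pair on the `p = 37` row -/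

/-- **The K1 rung leaf with r3's `p = 37` instance replaced by the Kriz–Li road.**  `SchneiderFree.AdditiveX3RankOneLower` (the lower half
of BSD_p on B6 ∩ X3 ∩ sst-twist, `r_an = 1`, every odd `p`) from: `PrintedFacts`; Mazur's Thm. 1 and `j`-table (named published facts);
Kriz–Li 2019 Thm. 1.20 (published); the (M) crux's instances at `p ∈ {3, 5, 7, 13}`; the (G-ord, `e = 2`) crux's instances at
`p ∈ {3, 5, 7, 13}` ONLY; and, on the `p = 37` row, for every curve and every line presentation `(T, r, f, φ)` with Teichmüller `ω`, an
imaginary quadratic Heegner field with odd `d_K`, its Kronecker character and the Bernoulli pair (4).  At `p ≠ 37` the crux currency comes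
from the row-prime instances (generation 35) and §1; at `p = 37` from `KrizLiLineData.missingLowerBoundAt_…_forall_linePresentation_five_le`
with (2) automatic (`KrizLiThirtySevenRow`).  CONDITIONAL on all displayed hypotheses; closes nothing; BSD is NOT advanced.
[cite: KrizLi2019, Thm. 1.20 (pp. 7–8)] [cite: Mazur1978, Thm. 1 and table p. 129] [cite: JetchevSkinnerWan2017, §7.4.1 (arXiv:1512.06894 p. 30)] -/
theorem additiveX3RankOneLower_of_printedFacts_of_rowPrimes_of_bernoulli37 (hF : PrintedFacts)
    (hM : mazur_isogeny_irreducible) (hJt : mazur_j_mem_of_not_hasIrreducibleModPGaloisRep_of_eleven_le)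
    (hKL : KrizLi2019.thm120_padicLogHeegner_unit_of_bernoulli)
    (h2 : ∀ (W : WeierstrassCurve ℚ) [W.IsElliptic] [W.IsGloballyMinimal] (p : ℕ) [Fact p.Prime],
      p = 3 ∨ p = 5 ∨ p = 7 ∨ p = 13 → W.analyticRank = 1 → ClassX3 W p → Additive.SubM W p → AdditiveIMCLowerBDPInputManinAt W p)
    (h3 : ∀ (W : WeierstrassCurve ℚ) [W.IsElliptic] [W.IsGloballyMinimal] (p : ℕ) [Fact p.Prime],
      p = 3 ∨ p = 5 ∨ p = 7 ∨ p = 13 → W.analyticRank = 1 → ClassX3 W p → Additive.SubGordTwo W p →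
        AdditiveIMCLowerBDPInputManinAt W p)
    (hB : ∀ (W : WeierstrassCurve ℚ) [W.IsElliptic] [W.IsGloballyMinimal] [Fact (Nat.Prime 37)],
      W.analyticRank = 1 → ClassX3 W 37 → Additive.SubSemistableTwist W 37 →
      ∀ (T : geomTorsion W ((37 : ℕ) : ℤ)) (r : absoluteGaloisGroup ℚ →* (ZMod 37)ˣ) (f : ℕ) [NeZero f]
        (φ : DirichletCharacter (ZMod 37) f) (ω : DirichletCharacter ℚ_[37] 37),
      T ≠ 0 → (∀ σ : absoluteGaloisGroup ℚ, σ • T = ((r σ : (ZMod 37)ˣ) : ZMod 37).val • T) → φ.IsPrimitive →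
      (∀ q : ℕ, q.Prime → q ∣ f → q ∣ 37 * W.conductorNorm ℤ) →
      (∀ σ : absoluteGaloisGroup ℚ, φ ((modNCyclotomicCharacter ℚ f σ : (ZMod f)ˣ) : ZMod f) = ((r σ : (ZMod 37)ˣ) : ZMod 37)) →
      IsTeichmullerCharacter ω →
      ∃ (K : Type) (_ : Field K) (_ : NumberField K) (εK : DirichletCharacter ℚ_[37] (NumberField.discr K).natAbs),
        IsImaginaryQuadratic K ∧ Odd (NumberField.discr K) ∧ SatisfiesHeegnerHypothesis (W.conductorNorm ℤ) K ∧
        IsKroneckerCharacterOf K εK ∧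
        ¬ (‖bernoulliOnePrim (bernoulliCharOne (MulChar.ofUnitHom (ω.toUnitHom.comp φ.toUnitHom) : DirichletCharacter ℚ_[37] f) εK) *
            bernoulliOnePrim (bernoulliCharTwo (MulChar.ofUnitHom (ω.toUnitHom.comp φ.toUnitHom) : DirichletCharacter ℚ_[37] f) εK ω)‖
            ≤ ((37 : ℕ) : ℝ)⁻¹)) :
    AdditiveX3RankOneLower := by
  intro W _ _ p hp hr hp2 hX hS
  by_cases h37 : p = 37
  · subst h37
    exact KrizLiLineData.missingLowerBoundAt_of_printedFacts_of_thm120_of_forall_linePresentation_five_le hF hKL W 37 hr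
      (by norm_num) hX hS (KrizLiThirtySevenRow.not_hasSplitMultiplicativeReductionAtPrime_of_classX3_thirtySeven hJt W hX)
      (fun T r f _ φ ω hT0 hrT hφp hfS hφ hω => hB W hr hX hS T r f φ ω hT0 hrT hφp hfS hφ hω)
  · refine missingLowerBoundAt_of_printedFacts_of_imcLowerInputAt hF W p hr hp2 hX hS ?_
    rcases hS with hSM | hSG
    · have hmem := KYBranchRowPrimesPotMult.mem_rowPrimesM_of_classX3_of_subM hM hJt W hX hSM
      simp only [Finset.mem_insert, Finset.mem_singleton] at hmem
      rcases hmem with h | h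
      · exact absurd h hp2
      · exact h2 W p h hr hX hSM
    · have hmem := KYBranchRowPrimes.mem_rowPrimes_of_classX3_of_subGordTwo hM hJt W hX hSG
      simp only [Finset.mem_insert, Finset.mem_singleton] at hmem
      rcases hmem with h | h | h | h | h | h
      · exact absurd h hp2
      · exact h3 W p (Or.inl h) hr hX hSG
      · exact h3 W p (Or.inr (Or.inl h)) hr hX hSG
      · exact h3 W p (Or.inr (Or.inr (Or.inl h))) hr hX hSG
      · exact h3 W p (Or.inr (Or.inr (Or.inr h))) hr hX hSG
      · exact absurd h h37

end Summit.BirchSwinnertonDyer.BirchSwinnertonDyer.Theorems.SchneiderFreeAdditiveX3.KrizLiLeafThirtySeven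

end
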